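import Literature.ModelTheory.FiniteModelTheory.DegreeParitySystemFP
import Literature.ModelTheory.FiniteModelTheory.SymmetricCircuitCountingWidthProofs
import Summits.PneNP.PneNP.Theorems.SymmetryBudgetWindowBarrierCoreReduction
import HarnessLib

/-!
# `PolylogBarrier`, step 2: no small budget-symmetric circuit decides the degree-parity class at a
# fooled order

Helper file of route `PneNP/SymmetryBudget`, item `PolylogBarrier` (stmt-PneNP-2147). The witness
language is `L = graphClassLanguage ParityFP.paritySolvableClass` (graphs whose degree-parity
system over `𝔽₂` is solvable; `Literature/…/DegreeParitySystemFP.lean`). This file proves the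
one-order core of the lower bound, **`no_small_budget_circuit`**: if at order `g` there are
`H₁ ∈ 𝒞`, `H₂ ∉ 𝒞` with `H₂ ≡^{C^{2k+2}} H₁`, and `s₀ + 2 + g² ≤ C(g, k)` (`8 < g`, `1 ≤ k`,
`k + 1 ≤ g/4`), then NO `tcBasis`-circuit on `(n+g) × (n+g)` inputs of size `≤ s₀`, symmetric
under the budget `Bud(n+g, g)`, computes the slice `x ↦ [⌜⟨n+g, Gr x⟩⌝ ∈ L]`. Chain (all in the
tree): restrict the circuit to the free block (`CoreReduction.exists_core_circuit`: square-
symmetric, two more gates, same values on planted matrices; planting does not change membership in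
the isomorphism-closed, padding-invariant class, `mem_paritySolvableClass_plant_iff`); rigidify and
read off supports of size `≤ k` from the orbit bound (`exists_reduced_rigidification_supports`, the
Dawar–Wilsenach support theorem); supports of size `k` cannot tell `≡^{C^{2k+2}}`-equivalent graphs
apart (`eval_adjInput_eq_of_ckEquiv`, Anderson–Dawar).
-/

-- `Summit.PneNP.PneNP.…` duplicates `PneNP` BY DESIGN (single-problem summit).
set_option linter.dupNamespace false

namespace Summit.PneNP.PneNP.Theorems

open Literature.ModelTheory.FiniteModelTheory Literature.Computability.Complexity
open scoped Classical

/-- A code lies in the language of a class iff the coded graph lies in the class (codes are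
injective). [folklore] -/
theorem encode_mem_graphClassLanguage_iff (C : Set FinGraph) (G : FinGraph) :
    encodingGraph.encode G ∈ graphClassLanguage C ↔ G ∈ C := by
  constructor
  · rintro ⟨G', hG', h⟩
    rwa [← encodingGraph.encode_injective h]
  · intro h
    exact ⟨G, h, rfl⟩

/-- **Planting does not change membership in the degree-parity class**: the graph on `Fin (n+g)`
read off a planted matrix of `G` (adjacency of `G` on the free block, `false` elsewhere) is `G`
plus `n` isolated vertices. [folklore] -/
theorem mem_paritySolvableClass_plant_iff {n g : ℕ} (G : SimpleGraph (Fin g))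
    (x : Fin (n + g) × Fin (n + g) → Bool)
    (hx0 : ∀ q : Fin (n + g) × Fin (n + g), ¬ (n ≤ (q.1 : ℕ) ∧ n ≤ (q.2 : ℕ)) → x q = false)
    (hx1 : ∀ q : Fin (n + g) × Fin (n + g), ∀ h : n ≤ (q.1 : ℕ) ∧ n ≤ (q.2 : ℕ),
      x q = decide (G.Adj ⟨q.1 - n, by omega⟩ ⟨q.2 - n, by omega⟩)) :
    (⟨n + g, SimpleGraph.fromRel fun u v => x (u, v) = true⟩ : FinGraph) ∈
        ParityFP.paritySolvableClass ↔ (⟨g, G⟩ : FinGraph) ∈ ParityFP.paritySolvableClass := by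
  classical
  rw [ParityFP.mem_paritySolvableClass_iff, ParityFP.mem_paritySolvableClass_iff]
  let f : Fin g → Fin (n + g) := fun j => ⟨n + j, by omega⟩
  have hf : Function.Injective f := fun j j' h => by
    simp only [f, Fin.mk.injEq] at h
    exact Fin.ext (by omega)
  have hxf : ∀ a c : Fin g, x (f a, f c) = decide (G.Adj a c) := by
    intro a c
    rw [hx1 (f a, f c) ⟨by simp [f], by simp [f]⟩]
    congr 2 <;> apply Fin.ext <;> simp [f]
  refine paritySolvable_iff_of_embedding hf (fun a c => ?_) ?_
  · rw [SimpleGraph.fromRel_adj, hxf, hxf, decide_eq_true_eq, decide_eq_true_eq, hf.ne_iff]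
    exact ⟨fun ⟨_, h⟩ => h.elim id fun h => h.symm, fun h => ⟨h.ne, Or.inl h⟩⟩
  · intro v hv w hadj
    have hvn : (v : ℕ) < n := by
      by_contra hle
      exact hv ⟨(v : ℕ) - n, by omega⟩ (Fin.ext (by simp [f]; omega))
    rw [SimpleGraph.fromRel_adj] at hadj
    rcases hadj.2 with h | h
    · rw [hx0 (v, w) (by simp; omega)] at h; exact Bool.false_ne_true h
    · rw [hx0 (w, v) (by simp; omega)] at h; exact Bool.false_ne_true h

/-- **No small budget-symmetric circuit computes the slice of `L` at a fooled order.** Let `𝒞` be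
the degree-parity class and `L` its language of codes. If `8 < g`, `1 ≤ k`, `k + 1 ≤ g/4`,
`s₀ + 2 + g² ≤ C(g,k)`, and some `H₁ ∈ 𝒞`, `H₂ ∉ 𝒞` on `Fin g` satisfy `H₂ ≡^{C^{2k+2}} H₁`, then
no `tcBasis`-circuit on `(n+g) × (n+g)` inputs of size `≤ s₀` that is symmetric under the budget
`Bud(n+g, g)` computes `x ↦ [⌜⟨n+g, Gr x⟩⌝ ∈ L]`. [folklore] -/
theorem no_small_budget_circuit {n g s₀ k : ℕ} (h8 : 8 < g) (hk1 : 1 ≤ k) (hk4 : k + 1 ≤ g / 4)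
    (hsize : s₀ + 2 + g ^ 2 ≤ g.choose k)
    (hpair : ∃ H₁ H₂ : SimpleGraph (Fin g), (⟨g, H₁⟩ : FinGraph) ∈ ParityFP.paritySolvableClass ∧
      (⟨g, H₂⟩ : FinGraph) ∉ ParityFP.paritySolvableClass ∧ CkEquiv (2 * k + 2) H₂ H₁) :
    ¬ ∃ C : Circuit (Fin (n + g) × Fin (n + g)), C.IsOver tcBasis ∧ C.size ≤ s₀ ∧
        C.IsSymmetricUnder (pointStabiliserBudget (n + g) g) ∧
        C.Computes fun x => decide (encodingGraph.encode
          ⟨n + g, SimpleGraph.fromRel fun u v => x (u, v) = true⟩ ∈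
            graphClassLanguage ParityFP.paritySolvableClass) := by
  classical
  rintro ⟨C, hB, hs, hsym, hcomp⟩
  obtain ⟨H₁, H₂, hH₁, hH₂, hck⟩ := hpair
  -- restrict to the free block
  obtain ⟨D, hDB, hDs, hDsym, hDval⟩ := CoreReduction.exists_core_circuit n g C hB hsym
  -- the restriction decides the class at order `g`
  have hdec : ∀ G : SimpleGraph (Fin g),
      D.eval (fun p : Fin g × Fin g => decide (G.Adj p.1 p.2)) =
        decide ((⟨g, G⟩ : FinGraph) ∈ ParityFP.paritySolvableClass) := by
    intro G
    obtain ⟨x, -, hx0, hx1⟩ := CoreReduction.exists_plant n G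
    rw [hDval G x hx0 hx1, hcomp x, decide_eq_decide, encode_mem_graphClassLanguage_iff]
    exact mem_paritySolvableClass_plant_iff G x hx0 hx1
  -- rigidify and bound the supports
  obtain ⟨D', hB', hsym', hev', horb', hsupp'⟩ := exists_reduced_rigidification_supports D hDB hDsym
  have horb : D'.orbitSize Set.univ ≤ g.choose k := by
    have h1 := D.orbitSize_le_size Set.univ
    rw [hDs] at h1
    omega
  have hsupp := hsupp' h8 k hk1 hk4 horb
  -- supports of size `k` do not separate `≡^{C^{2k+2}}`-equivalent graphs
  have key := eval_adjInput_eq_of_ckEquiv hB' hsym' hsupp hck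
  rw [hev', hev'] at key
  change D.eval (fun p : Fin g × Fin g => decide (H₂.Adj p.1 p.2)) =
    D.eval (fun p : Fin g × Fin g => decide (H₁.Adj p.1 p.2)) at key
  rw [hdec H₂, hdec H₁, decide_eq_false hH₂, decide_eq_true hH₁] at key
  exact Bool.false_ne_true key

end Summit.PneNP.PneNP.Theorems
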